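import Literature.AlgebraicGeometry.Motives.LineSweptPlanes
import Literature.AlgebraicGeometry.Motives.QuadraticFormHessian
import Mathlib.RingTheory.Nullstellensatz
import HarnessLib

/-!
# Quadric surfaces of `X` are line-swept

R. Mboro, *Remarks on the `CH₂` of cubic hypersurfaces* (arXiv:1701.04488), proof of Prop. 1.4
(p. 8): the class `H_X^{n-2} = [X ∩ P₀]` of a `3`-plane section of the cubic `X` lies in the image
of the universal-line correspondence `P_*`, because the cubic surface `X ∩ P₀` "is ruled by lines
of `X`. Indeed, for any `x ∈ S ∖ l₀`, `span(x, l₀) ∩ S` is a plane cubic containing `l₀` …; so that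
the residual curve is a line passing through `x`". This file proves the RESIDUAL-LINE argument for
the quadric component `Q` of a section `X ∩ M = Π ∪ Q` through a plane `Π ⊆ X`
(`Motives/CubicHyperplaneClassLineSwept`): for a line `l₀ ⊆ Q` and the pencil of planes
`H_t = span(l₀, z_t) ⊆ M`, `H_t ∩ Q = l₀ ∪ l_t` with `l_t` the residual LINE, and the lines `l_t`
sweep out `Q`.

* `ProjFamily.isLineSweptPoint_of_mem_quadricSurface` — **for a `3`-plane `M = V₊(L) ⊆ ℙᵈ⁺¹_k`
  (`k` algebraically closed, `2 ≠ 0`), a quadratic form `q` such that `Q = M ∩ V₊(q)` lies on the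
  closed subscheme `X` and contains NO plane of `M`, every point `η ∈ X` of dimension `2` lying on
  `Q` (`q, L ∈ 𝔭_η`) is line-swept** (`ProjFamily.IsLineSweptPoint`, `Motives/LineSweptSurfaces`).
  The family of residual lines is taken over the abstract curve of `Motives/LineSweptPlanes`
  (`K = k(B)`, `τ ∈ K` transcendental): `l_τ ⊆ Q_K` specialises to a point `y_Q ∈ X`
  (`exists_point_of_fibre_line`) with `y_Q ⤳ η` — a form over `k` vanishing on `l_τ` vanishes on
  every `l_t`, `t ∈ k`, hence (times two linear forms) on `Q(k)`, hence lies in `𝔭_η` by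
  Hilbert's Nullstellensatz (Mathlib `MvPolynomial.vanishingIdeal_zeroLocus_eq_radical`) and the
  absence of planes in `Q` — and `dim y_Q = 2`, so `η = y_Q`.
* Algebra of quadratic forms through the Hessian (`Motives/QuadraticFormHessian`): the polar form
  `ProjFamily.qpolar`, `q(s u + t v) = s² q(u) + s t B(u, v) + t² q(v)`, isotropic vectors and an
  isotropic `2`-plane inside any `4`-frame over an algebraically closed field
  (`exists_isotropic_frame`), and the exchange lemma `linearIndependent_update_of_sum`.

Everything is proved; no named facts.

## References

* [Mboro2018] R. Mboro, Remarks on the CH₂ of cubic hypersurfaces, arXiv:1701.04488, proof of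
  Prop. 1.4 (p. 8).
* [Hartshorne1977] R. Hartshorne, Algebraic Geometry (1977), I Thm. 1.3A (Nullstellensatz),
  I Ex. 2.11, I Ex. 5.8.
-/

noncomputable section

open CategoryTheory CategoryTheory.Limits AlgebraicGeometry MonoidalCategory MvPolynomial
  TopologicalSpace Order Topology Matrix
open Literature.AlgebraicGeometry.Motives.Segre Literature.AlgebraicGeometry.Motives.RatFn
open Literature.FieldTheory.QuasiAlgClosed (IsCrSystem.eval_map_algebraMap)

universe u

namespace Literature.AlgebraicGeometry.Motives

attribute [local instance] MvPolynomial.gradedAlgebra MvPolynomial.algebraMvPolynomial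
  Literature.AlgebraicGeometry.Motives.ProjBaseChange.algebraBase
  UniversalHyperplaneSection.sectionsAlgebra ProjFamily.functionFieldAlgebra

namespace ProjFamily

open ProjBaseChangeRing ProjectiveSpaceCells ProjectiveSpace ProjSpace
  Literature.RingTheory.MvPolynomial

/-! ### Quadratic forms through the Hessian -/

section Quadratic

variable {K : Type*} [Field K] {n : ℕ}

/-- The polar bilinear form `B(u, v) = uᵀ (Hess q) v` of a quadratic form `q` (`2 q(v) = B(v, v)`,
`Motives/QuadraticFormHessian`). [folklore] -/
def qpolar (q : MvPolynomial (Fin (n + 1)) K) (u v : Fin (n + 1) → K) : K := u ⬝ᵥ (hessian q *ᵥ v)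

variable (q : MvPolynomial (Fin (n + 1)) K)

/-- `B` is symmetric. [folklore] -/
theorem qpolar_comm (u v : Fin (n + 1) → K) : qpolar q u v = qpolar q v u := by
  unfold qpolar
  rw [Matrix.dotProduct_mulVec, ← Matrix.mulVec_transpose, hessian_transpose, dotProduct_comm]

/-- `B` is additive on the right. [folklore] -/
theorem qpolar_add_right (u v w : Fin (n + 1) → K) : qpolar q u (v + w) = qpolar q u v + qpolar q u w := by
  simp [qpolar, Matrix.mulVec_add, dotProduct_add]

/-- `B` is homogeneous on the right. [folklore] -/
theorem qpolar_smul_right (c : K) (u v : Fin (n + 1) → K) : qpolar q u (c • v) = c * qpolar q u v := by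
  simp [qpolar, Matrix.mulVec_smul, dotProduct_smul]

/-- `B` is additive on the left. [folklore] -/
theorem qpolar_add_left (u v w : Fin (n + 1) → K) : qpolar q (u + v) w = qpolar q u w + qpolar q v w := by
  rw [qpolar_comm, qpolar_add_right, qpolar_comm q w u, qpolar_comm q w v]

/-- `B` is homogeneous on the left. [folklore] -/
theorem qpolar_smul_left (c : K) (u v : Fin (n + 1) → K) : qpolar q (c • u) v = c * qpolar q u v := by
  rw [qpolar_comm, qpolar_smul_right, qpolar_comm q v u]

/-- `B(u, 0) = 0`. [folklore] -/
theorem qpolar_zero_right (u : Fin (n + 1) → K) : qpolar q u 0 = 0 := by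
  simp [qpolar]

variable {q}

/-- **Euler: `2 q(v) = B(v, v)`.** [folklore] -/
theorem two_mul_eval_eq_qpolar (hq : q.IsHomogeneous 2) (v : Fin (n + 1) → K) :
    2 * eval v q = qpolar q v v :=
  two_mul_eval_eq hq v

/-- **`q(u + v) = q(u) + B(u, v) + q(v)`** (`2 ≠ 0`). [folklore] -/
theorem eval_add_eq_qpolar (hq : q.IsHomogeneous 2) (h2 : (2 : K) ≠ 0) (u v : Fin (n + 1) → K) :
    eval (u + v) q = eval u q + qpolar q u v + eval v q := by
  apply mul_left_cancel₀ h2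
  rw [two_mul_eval_eq_qpolar hq, mul_add, mul_add, two_mul_eval_eq_qpolar hq,
    two_mul_eval_eq_qpolar hq, qpolar_add_left, qpolar_add_right, qpolar_add_right, qpolar_comm q v u]
  ring

/-- **`q(c v) = c² q(v)`** (`2 ≠ 0`). [folklore] -/
theorem eval_smul_eq_sq_mul (hq : q.IsHomogeneous 2) (h2 : (2 : K) ≠ 0) (c : K) (v : Fin (n + 1) → K) :
    eval (c • v) q = c ^ 2 * eval v q := by
  apply mul_left_cancel₀ h2
  rw [two_mul_eval_eq_qpolar hq, qpolar_smul_left, qpolar_smul_right, mul_left_comm,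
    ← two_mul_eval_eq_qpolar hq]
  ring

/-- **`q(s u + t v) = s² q(u) + s t B(u, v) + t² q(v)`.** [folklore] -/
theorem eval_add_smul_smul_eq (hq : q.IsHomogeneous 2) (h2 : (2 : K) ≠ 0) (s t : K)
    (u v : Fin (n + 1) → K) :
    eval (s • u + t • v) q = s ^ 2 * eval u q + s * t * qpolar q u v + t ^ 2 * eval v q := by
  rw [eval_add_eq_qpolar hq h2, eval_smul_eq_sq_mul hq h2, eval_smul_eq_sq_mul hq h2,
    qpolar_smul_left, qpolar_smul_right]
  ring

/-- `B(u, v)` as a value of a linear form: the tangent form `λ_u = Σ_j (Hess q · u)_j x_j` at `u`.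
[folklore] -/
theorem eval_lin_hessian_mulVec (q : MvPolynomial (Fin (n + 1)) K) (u P : Fin (n + 1) → K) :
    eval P (lin (hessian q *ᵥ u)) = qpolar q u P := by
  rw [eval_lin, qpolar_comm]
  unfold qpolar
  rw [dotProduct_comm]

/-- A totally isotropic pair: `q ≡ 0` on `span(a, b)` gives `B(a, b) = 0`. [folklore] -/
theorem qpolar_eq_zero_of_isotropic (hq : q.IsHomogeneous 2) (h2 : (2 : K) ≠ 0) {a b : Fin (n + 1) → K}
    (h : ∀ s t : K, eval (s • a + t • b) q = 0) : qpolar q a b = 0 := by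
  have h1 := h 1 1
  rw [eval_add_smul_smul_eq hq h2] at h1
  have ha : eval a q = 0 := by simpa using h 1 0
  have hb : eval b q = 0 := by simpa using h 0 1
  simpa [ha, hb] using h1

/-! #### Scalar extension -/

/-- The Hessian commutes with scalar extension. [folklore] -/
theorem hessian_map {k : Type*} [Field k] (ι : k →+* K) (q : MvPolynomial (Fin (n + 1)) k) :
    hessian (MvPolynomial.map ι q) = (hessian q).map ι := by
  ext j l
  simp [hessian, MvPolynomial.pderiv_map, MvPolynomial.coeff_map]

/-- `B_{q ⊗ 1}(ι u, ι v) = ι B_q(u, v)`. [folklore] -/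
theorem qpolar_map {k : Type*} [Field k] (ι : k →+* K) (q : MvPolynomial (Fin (n + 1)) k)
    (u v : Fin (n + 1) → k) :
    qpolar (MvPolynomial.map ι q) (fun j => ι (u j)) (fun j => ι (v j)) = ι (qpolar q u v) := by
  unfold qpolar
  rw [hessian_map, RingHom.map_dotProduct]
  congr 1
  funext j
  exact (RingHom.map_mulVec ι (hessian q) v j).symm

/-! #### Isotropic vectors over an algebraically closed field -/

variable [IsAlgClosed K]

/-- **A quadratic form on a `2`-space over an algebraically closed field has a non-trivial zero**:
`q(s u + t v) = 0` for some `(s, t) ≠ (0, 0)`. [folklore] -/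
theorem exists_isotropic_combination (hq : q.IsHomogeneous 2) (h2 : (2 : K) ≠ 0)
    (u v : Fin (n + 1) → K) : ∃ s t : K, (s ≠ 0 ∨ t ≠ 0) ∧ eval (s • u + t • v) q = 0 := by
  by_cases hu : eval u q = 0
  · exact ⟨1, 0, Or.inl one_ne_zero, by simpa using hu⟩
  · -- the quadratic `q(u) X² + B(u,v) X + q(v)` has a root
    let p : Polynomial K := Polynomial.C (eval u q) * Polynomial.X ^ 2 +
      Polynomial.C (qpolar q u v) * Polynomial.X + Polynomial.C (eval v q)
    have hdeg : p.degree = 2 := Polynomial.degree_quadratic hu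
    obtain ⟨r, hr⟩ := IsAlgClosed.exists_root p (by rw [hdeg]; decide)
    refine ⟨r, 1, Or.inr one_ne_zero, ?_⟩
    rw [eval_add_smul_smul_eq hq h2]
    have h : Polynomial.eval r p = 0 := hr
    simp only [p, Polynomial.eval_add, Polynomial.eval_mul, Polynomial.eval_C, Polynomial.eval_pow,
      Polynomial.eval_X] at h
    linear_combination h

end Quadratic

/-! ### The exchange lemma and isotropic frames -/

section Frames

variable {K : Type*} [Field K] {V : Type*} [AddCommGroup V] [Module K V]

/-- **Exchange lemma**: replacing a vector of an independent family by a combination in which it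
occurs with non-zero coefficient keeps the family independent. [folklore] -/
theorem linearIndependent_update_of_sum {ι : Type*} [Fintype ι] [DecidableEq ι] {v : ι → V}
    (hv : LinearIndependent K v) (g : ι → K) (p : ι) (hp : g p ≠ 0) :
    LinearIndependent K (Function.update v p (∑ i, g i • v i)) := by
  rw [Fintype.linearIndependent_iff]
  intro c hc i
  -- expand the relation in the frame `v`
  have hexp : ∑ i, c i • Function.update v p (∑ j, g j • v j) i =
      ∑ i, (Function.update c p 0 i + c p * g i) • v i := by
    have h1 : ∀ i, c i • Function.update v p (∑ j, g j • v j) i =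
        Function.update c p 0 i • v i + (if i = p then c p • ∑ j, g j • v j else 0) := by
      intro i
      by_cases hi : i = p
      · subst hi; simp
      · simp [hi]
    simp_rw [h1, Finset.sum_add_distrib, Finset.sum_ite_eq' Finset.univ p, Finset.mem_univ, if_true,
      Finset.smul_sum, smul_smul, add_smul, Finset.sum_add_distrib]
  rw [hexp] at hc
  have hall := (Fintype.linearIndependent_iff.1 hv) _ hc
  have hcp : c p = 0 := by
    have h := hall p
    simp only [Function.update_self, zero_add] at h
    exact (mul_eq_zero.1 h).resolve_right hp
  by_cases hi : i = p
  · rw [hi]; exact hcp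
  · have h := hall i
    rwa [Function.update_of_ne hi, hcp, zero_mul, add_zero] at h

variable {n : ℕ} [IsAlgClosed K] {q : MvPolynomial (Fin (n + 1)) K}

/-- **An isotropic vector replacing a frame vector**: in a `4`-frame `m`, the first vector can be
replaced by a non-zero isotropic vector `a ∈ span(m₀, m₁)`. [folklore] -/
theorem exists_isotropic_update_zero (hq : q.IsHomogeneous 2) (h2 : (2 : K) ≠ 0)
    (m : Fin 4 → Fin (n + 1) → K) (hm : LinearIndependent K m) :
    ∃ m' : Fin 4 → Fin (n + 1) → K, LinearIndependent K m' ∧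
      (∀ c, m' c ∈ Submodule.span K (Set.range m)) ∧ eval (m' 0) q = 0 := by
  classical
  obtain ⟨s, t, hst, hiso⟩ := exists_isotropic_combination hq h2 (m 0) (m 1)
  have hmem : s • m 0 + t • m 1 ∈ Submodule.span K (Set.range m) :=
    Submodule.add_mem _ (Submodule.smul_mem _ _ (Submodule.subset_span ⟨0, rfl⟩))
      (Submodule.smul_mem _ _ (Submodule.subset_span ⟨1, rfl⟩))
  rcases hst with hs | ht
  · -- replace `m₀`
    let g : Fin 4 → K := ![s, t, 0, 0]
    have hsum : ∑ i, g i • m i = s • m 0 + t • m 1 := by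
      simp [g, Fin.sum_univ_four]
    refine ⟨Function.update m 0 (∑ i, g i • m i), linearIndependent_update_of_sum hm g 0 hs, ?_, ?_⟩
    · intro c
      by_cases hc : c = 0
      · subst hc; rw [Function.update_self, hsum]; exact hmem
      · rw [Function.update_of_ne hc]; exact Submodule.subset_span ⟨c, rfl⟩
    · rw [Function.update_self, hsum]; exact hiso
  · -- replace `m₁`, then swap `0 ↔ 1`
    let g : Fin 4 → K := ![s, t, 0, 0]
    have hsum : ∑ i, g i • m i = s • m 0 + t • m 1 := by
      simp [g, Fin.sum_univ_four]
    have hli := linearIndependent_update_of_sum hm g 1 ht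
    let σ : Equiv.Perm (Fin 4) := Equiv.swap 0 1
    refine ⟨Function.update m 1 (∑ i, g i • m i) ∘ σ, hli.comp σ σ.injective, ?_, ?_⟩
    · intro c
      change Function.update m 1 (∑ i, g i • m i) (σ c) ∈ _
      by_cases hc : σ c = 1
      · rw [hc, Function.update_self, hsum]; exact hmem
      · rw [Function.update_of_ne hc]; exact Submodule.subset_span ⟨σ c, rfl⟩
    · change eval (Function.update m 1 (∑ i, g i • m i) (σ 0)) q = 0
      rw [show σ 0 = 1 from Equiv.swap_apply_left 0 1, Function.update_self, hsum]
      exact hiso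

omit [IsAlgClosed K] in
/-- **The recipe for the second isotropic vector**: in a frame `m₁` with `q(m₁ 0) = 0`, a
combination `b = Σ g_c m₁ c` not involving `m₁ 0`, with `B(m₁ 0, b) = 0`, `q(b) = 0` and some
coefficient `g p ≠ 0`, gives the isotropic frame `(m₁ 0, b, …)`. [folklore] -/
theorem isotropic_frame_recipe (hq : q.IsHomogeneous 2) (h2 : (2 : K) ≠ 0)
    (m₁ : Fin 4 → Fin (n + 1) → K) (hm₁ : LinearIndependent K m₁) (ha : eval (m₁ 0) q = 0)
    (g : Fin 4 → K) (p : Fin 4) (hp0 : p ≠ 0) (hgp : g p ≠ 0)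
    (hpol : qpolar q (m₁ 0) (∑ c, g c • m₁ c) = 0) (hiso : eval (∑ c, g c • m₁ c) q = 0) :
    ∃ m' : Fin 4 → Fin (n + 1) → K, LinearIndependent K m' ∧
      (∀ c, m' c ∈ Submodule.span K (Set.range m₁)) ∧
        ∀ s t : K, eval (s • m' 0 + t • m' 1) q = 0 := by
  classical
  set b := ∑ c, g c • m₁ c with hb
  have hbmem : b ∈ Submodule.span K (Set.range m₁) :=
    Submodule.sum_mem _ fun c _ => Submodule.smul_mem _ _ (Submodule.subset_span ⟨c, rfl⟩)
  have hli := linearIndependent_update_of_sum hm₁ g p hgp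
  -- reorder so that `a, b` come first: swap `1 ↔ p`
  let σ : Equiv.Perm (Fin 4) := Equiv.swap 1 p
  have hσ0 : σ 0 = 0 := Equiv.swap_apply_of_ne_of_ne (by decide) (Ne.symm hp0)
  have hσ1 : σ 1 = p := Equiv.swap_apply_left 1 p
  refine ⟨Function.update m₁ p b ∘ σ, hli.comp σ σ.injective, ?_, ?_⟩
  · intro c
    change Function.update m₁ p b (σ c) ∈ _
    by_cases hc : σ c = p
    · rw [hc, Function.update_self]; exact hbmem
    · rw [Function.update_of_ne hc]; exact Submodule.subset_span ⟨σ c, rfl⟩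
  · intro s t
    change eval (s • Function.update m₁ p b (σ 0) + t • Function.update m₁ p b (σ 1)) q = 0
    rw [hσ0, hσ1, Function.update_of_ne (Ne.symm hp0), Function.update_self,
      eval_add_smul_smul_eq hq h2, ha, hpol, hiso]
    ring

/-- The case `B(a, m₁ 3) ≠ 0` of `exists_isotropic_frame_of_isotropic_zero`: kill `B(a, ·)`
against `m₁ 3` and take an isotropic vector of the resulting `2`-space. [folklore] -/
theorem exists_isotropic_frame_of_qpolar_three_ne_zero (hq : q.IsHomogeneous 2) (h2 : (2 : K) ≠ 0)
    (m₁ : Fin 4 → Fin (n + 1) → K) (hm₁ : LinearIndependent K m₁) (ha : eval (m₁ 0) q = 0)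
    (hf3 : qpolar q (m₁ 0) (m₁ 3) ≠ 0) :
    ∃ m' : Fin 4 → Fin (n + 1) → K, LinearIndependent K m' ∧
      (∀ c, m' c ∈ Submodule.span K (Set.range m₁)) ∧
        ∀ s t : K, eval (s • m' 0 + t • m' 1) q = 0 := by
  classical
  set a := m₁ 0 with ha_def
  let f : Fin 4 → K := fun c => qpolar q a (m₁ c)
  have hf3' : f 3 ≠ 0 := hf3
  let u₁ : Fin (n + 1) → K := f 3 • m₁ 1 - f 1 • m₁ 3
  let u₂ : Fin (n + 1) → K := f 3 • m₁ 2 - f 2 • m₁ 3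
  have hu₁ : qpolar q a u₁ = 0 := by
    change qpolar q a (f 3 • m₁ 1 - f 1 • m₁ 3) = 0
    rw [sub_eq_add_neg, ← neg_smul, qpolar_add_right, qpolar_smul_right, qpolar_smul_right]
    change f 3 * f 1 + -f 1 * f 3 = 0
    ring
  have hu₂ : qpolar q a u₂ = 0 := by
    change qpolar q a (f 3 • m₁ 2 - f 2 • m₁ 3) = 0
    rw [sub_eq_add_neg, ← neg_smul, qpolar_add_right, qpolar_smul_right, qpolar_smul_right]
    change f 3 * f 2 + -f 2 * f 3 = 0
    ring
  obtain ⟨s, t, hst, hiso⟩ := exists_isotropic_combination hq h2 u₁ u₂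
  -- `b = s u₁ + t u₂ = (s f 3) m₁ 1 + (t f 3) m₁ 2 - (s f 1 + t f 2) m₁ 3`
  let g : Fin 4 → K := ![0, s * f 3, t * f 3, -(s * f 1 + t * f 2)]
  have hsum : ∑ c, g c • m₁ c = s • u₁ + t • u₂ := by
    rw [Fin.sum_univ_four]
    change (0 : K) • m₁ 0 + (s * f 3) • m₁ 1 + (t * f 3) • m₁ 2 + (-(s * f 1 + t * f 2)) • m₁ 3 =
      s • (f 3 • m₁ 1 - f 1 • m₁ 3) + t • (f 3 • m₁ 2 - f 2 • m₁ 3)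
    simp only [zero_smul, zero_add, smul_sub, smul_smul, neg_add, add_smul, neg_smul]
    abel
  have hpol : qpolar q a (∑ c, g c • m₁ c) = 0 := by
    rw [hsum, qpolar_add_right, qpolar_smul_right, qpolar_smul_right, hu₁, hu₂, mul_zero, mul_zero,
      add_zero]
  have hiso' : eval (∑ c, g c • m₁ c) q = 0 := by rw [hsum]; exact hiso
  rcases hst with hs | ht
  · exact isotropic_frame_recipe hq h2 m₁ hm₁ ha g 1 (by decide) (mul_ne_zero hs hf3') hpol hiso'
  · exact isotropic_frame_recipe hq h2 m₁ hm₁ ha g 2 (by decide) (mul_ne_zero ht hf3') hpol hiso'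

/-- **Completing an isotropic vector to an isotropic frame**: a frame `m₁` with `q(m₁ 0) = 0` can
be changed, inside `span(m₁)`, into a frame whose first two vectors span a totally isotropic plane.
[folklore] -/
theorem exists_isotropic_frame_of_isotropic_zero (hq : q.IsHomogeneous 2) (h2 : (2 : K) ≠ 0)
    (m₁ : Fin 4 → Fin (n + 1) → K) (hm₁ : LinearIndependent K m₁) (ha : eval (m₁ 0) q = 0) :
    ∃ m' : Fin 4 → Fin (n + 1) → K, LinearIndependent K m' ∧
      (∀ c, m' c ∈ Submodule.span K (Set.range m₁)) ∧
        ∀ s t : K, eval (s • m' 0 + t • m' 1) q = 0 := by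
  classical
  set a := m₁ 0 with ha_def
  let f : Fin 4 → K := fun c => qpolar q a (m₁ c)
  by_cases h23 : f 2 = 0 ∧ f 3 = 0
  · -- `b` isotropic in `span(m₁ 2, m₁ 3)`
    obtain ⟨s, t, hst, hiso⟩ := exists_isotropic_combination hq h2 (m₁ 2) (m₁ 3)
    let g : Fin 4 → K := ![0, 0, s, t]
    have hsum : ∑ c, g c • m₁ c = s • m₁ 2 + t • m₁ 3 := by
      rw [Fin.sum_univ_four]
      change (0 : K) • m₁ 0 + (0 : K) • m₁ 1 + s • m₁ 2 + t • m₁ 3 = _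
      rw [zero_smul, zero_smul, zero_add, zero_add]
    have hpol : qpolar q a (∑ c, g c • m₁ c) = 0 := by
      rw [hsum, qpolar_add_right, qpolar_smul_right, qpolar_smul_right]
      change s * f 2 + t * f 3 = 0
      rw [h23.1, h23.2, mul_zero, mul_zero, add_zero]
    have hiso' : eval (∑ c, g c • m₁ c) q = 0 := by rw [hsum]; exact hiso
    rcases hst with hs | ht
    · exact isotropic_frame_recipe hq h2 m₁ hm₁ ha g 2 (by decide) hs hpol hiso'
    · exact isotropic_frame_recipe hq h2 m₁ hm₁ ha g 3 (by decide) ht hpol hiso'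
  · by_cases h3 : f 3 = 0
    · -- `f 2 ≠ 0`: swap the indices `2 ↔ 3`
      have hf2 : f 2 ≠ 0 := fun h => h23 ⟨h, h3⟩
      let σ : Equiv.Perm (Fin 4) := Equiv.swap 2 3
      have hm₂ : LinearIndependent K (m₁ ∘ σ) := hm₁.comp σ σ.injective
      have h0 : (m₁ ∘ σ) 0 = m₁ 0 := by
        change m₁ (σ 0) = m₁ 0; rw [Equiv.swap_apply_of_ne_of_ne (by decide) (by decide)]
      have h3' : (m₁ ∘ σ) 3 = m₁ 2 := by
        change m₁ (σ 3) = m₁ 2; rw [Equiv.swap_apply_right]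
      obtain ⟨m', hm', hspan, hiso⟩ := exists_isotropic_frame_of_qpolar_three_ne_zero hq h2 (m₁ ∘ σ)
        hm₂ (by rw [h0]; exact ha) (by rw [h0, h3']; exact hf2)
      refine ⟨m', hm', fun c => ?_, hiso⟩
      have hle : Submodule.span K (Set.range (m₁ ∘ σ)) ≤ Submodule.span K (Set.range m₁) :=
        Submodule.span_mono (by rintro _ ⟨c', rfl⟩; exact ⟨σ c', rfl⟩)
      exact hle (hspan c)
    · exact exists_isotropic_frame_of_qpolar_three_ne_zero hq h2 m₁ hm₁ ha h3

/-- **Isotropic `2`-planes in a `4`-frame.** For a quadratic form `q` over an algebraically closed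
field with `2 ≠ 0` and four independent vectors `m`, there is a frame `m'` of `span(m)` whose first
two vectors span a totally isotropic plane: `q(s m'₀ + t m'₁) = 0` for all `s, t` (every quadric
surface contains a line). [folklore] -/
theorem exists_isotropic_frame (hq : q.IsHomogeneous 2) (h2 : (2 : K) ≠ 0)
    (m : Fin 4 → Fin (n + 1) → K) (hm : LinearIndependent K m) :
    ∃ m' : Fin 4 → Fin (n + 1) → K, LinearIndependent K m' ∧
      (∀ c, m' c ∈ Submodule.span K (Set.range m)) ∧
        ∀ s t : K, eval (s • m' 0 + t • m' 1) q = 0 := by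
  obtain ⟨m₁, hm₁, hm₁span, ha⟩ := exists_isotropic_update_zero hq h2 m hm
  obtain ⟨m', hm', hspan, hiso⟩ := exists_isotropic_frame_of_isotropic_zero hq h2 m₁ hm₁ ha
  refine ⟨m', hm', fun c => ?_, hiso⟩
  exact (Submodule.span_le.2 (by rintro _ ⟨c', rfl⟩; exact hm₁span c')) (hspan c)

end Frames

/-! ### Specialising a transcendental parameter along a polynomial path -/

section Path

variable {k : Type u} [Field k] {K : Type*} [Field K] [Algebra k K]

/-- `G(γ(T))` evaluates at `x` to `G(γ(x))`. [folklore] -/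
theorem aeval_aeval_path {L : Type*} [CommRing L] [Algebra k L] {n : ℕ} (G : MvPolynomial (Fin n) k)
    (γ : Fin n → Polynomial k) (x : L) :
    Polynomial.aeval x (aeval γ G) = aeval (fun j => Polynomial.aeval x (γ j)) G := by
  change (Polynomial.aeval x).comp (aeval γ) G = _
  rw [MvPolynomial.comp_aeval]

/-- **`G(γ(τ)) = 0` for a polynomial path `γ` and `τ` transcendental over `k` forces `G(γ(t)) = 0`
for every `t ∈ k`.** [folklore] -/
theorem eval_path_eq_zero_of_transcendental {τ : K} (hτ : Transcendental k τ) {n : ℕ}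
    (G : MvPolynomial (Fin n) k) (γ : Fin n → Polynomial k)
    (h : eval (fun j => Polynomial.aeval τ (γ j)) (MvPolynomial.map (algebraMap k K) G) = 0) (t : k) :
    eval (fun j => (γ j).eval t) G = 0 := by
  set p : Polynomial k := aeval γ G with hp
  have hpτ : Polynomial.aeval τ p = 0 := by
    rw [hp, aeval_aeval_path, ← h, MvPolynomial.eval_map, ← MvPolynomial.aeval_def]
  have hp0 : p = 0 := (transcendental_iff_injective.mp hτ) (by rw [hpτ, map_zero])
  have ht : Polynomial.aeval t p = eval (fun j => (γ j).eval t) G := by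
    rw [hp, aeval_aeval_path, show aeval (fun j => Polynomial.aeval t (γ j)) G =
      eval (fun j => Polynomial.aeval t (γ j)) G from congrFun (MvPolynomial.aeval_eq_eval (f := _)) G]
    rfl
  rw [← ht, hp0, map_zero]

/-- A non-trivial `k`-linear expression in a transcendental is non-zero. [folklore] -/
theorem algebraMap_add_mul_ne_zero_of_transcendental {τ : K} (hτ : Transcendental k τ) {p₀ p₁ : k}
    (h : p₀ ≠ 0 ∨ p₁ ≠ 0) : algebraMap k K p₀ + τ * algebraMap k K p₁ ≠ 0 := by
  intro h0
  have hP : Polynomial.aeval τ (Polynomial.C p₀ + Polynomial.X * Polynomial.C p₁) = 0 := by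
    rw [map_add, map_mul, Polynomial.aeval_C, Polynomial.aeval_X, Polynomial.aeval_C]
    exact h0
  have hz : Polynomial.C p₀ + Polynomial.X * Polynomial.C p₁ = 0 :=
    (transcendental_iff_injective.mp hτ) (by rw [hP, map_zero])
  have h0' : (Polynomial.C p₀ + Polynomial.X * Polynomial.C p₁).coeff 0 = 0 := by
    rw [hz, Polynomial.coeff_zero]
  have h1' : (Polynomial.C p₀ + Polynomial.X * Polynomial.C p₁).coeff 1 = 0 := by
    rw [hz, Polynomial.coeff_zero]
  simp only [Polynomial.coeff_add, Polynomial.coeff_C_zero, Polynomial.coeff_X_mul_zero, add_zero,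
    Polynomial.coeff_C_succ, Polynomial.coeff_X_mul, zero_add] at h0' h1'
  rcases h with h | h
  · exact h h0'
  · exact h h1'

end Path

/-! ### Quadric surfaces containing no plane -/

section NoPlane

variable {k : Type u} [Field k] {d : ℕ} (X : SchemeOver k) (i : X ⟶ projectiveSpace (d + 1) k)
  [IsClosedImmersion i.left]

/-- **A surface point on `Q = M ∩ V₊(q)` lies on no plane `V₊(λ) ∩ M` of `M` unless `Q` contains
that plane.** For a `3`-plane `M = V₊(L)` with frame `m`, a quadratic form `q` containing no plane
of `M`, and `η ∈ X` of dimension `2` with `q, L ∈ 𝔭_η`: a linear form `λ ∈ 𝔭_η` vanishes on `M`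
(otherwise `η` would be the generic point of the plane `V₊(L, λ)`, and `q ∈ 𝔭_η = (L, λ)` would
vanish on it). [cite: Hartshorne1977, I Ex. 2.11] -/
theorem forall_eval_eq_zero_of_linear_mem {c : ℕ} (hc : c + 3 = d + 1)
    (L : Fin c → MvPolynomial (Fin (d + 1 + 1)) k) (hLhom : ∀ j, (L j).IsHomogeneous 1)
    (hLli : LinearIndependent k L) (M : Submodule k (Fin (d + 1 + 1) → k))
    (hLM : ∀ P : Fin (d + 1 + 1) → k, (∀ j, eval P (L j) = 0) ↔ P ∈ M)
    {q : MvPolynomial (Fin (d + 1 + 1)) k}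
    (hnoplane : ∀ lam : MvPolynomial (Fin (d + 1 + 1)) k, lam.IsHomogeneous 1 →
      (∀ v ∈ M, eval v lam = 0 → eval v q = 0) → ∀ v ∈ M, eval v lam = 0)
    {η : ↥X.left} (hη2 : height η = 2)
    (hqη : q ∈ ProjectiveSpectrum.asHomogeneousIdeal
      (𝒜 := homogeneousSubmodule (Fin (d + 1 + 1)) k) (i.left.base η))
    (hLη : ∀ j, L j ∈ ProjectiveSpectrum.asHomogeneousIdeal
      (𝒜 := homogeneousSubmodule (Fin (d + 1 + 1)) k) (i.left.base η))
    {lam : MvPolynomial (Fin (d + 1 + 1)) k} (hlam : lam.IsHomogeneous 1)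
    (hlamη : lam ∈ ProjectiveSpectrum.asHomogeneousIdeal
      (𝒜 := homogeneousSubmodule (Fin (d + 1 + 1)) k) (i.left.base η)) :
    ∀ v ∈ M, eval v lam = 0 := by
  by_contra hne
  push Not at hne
  obtain ⟨v₀, hv₀M, hv₀⟩ := hne
  -- `λ ∉ (L)`, so `(L, λ)` is an independent family of `c + 1` linear forms
  have hnot : lam ∉ Ideal.span (Set.range L) := by
    intro h
    exact hv₀ (eval_eq_zero_of_mem_idealSpan_of_forall (fun j => ((hLM v₀).2 hv₀M) j) h)
  have hind : LinearIndependent k (Fin.snoc L lam) := by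
    refine linearIndependent_finSnoc.2 ⟨hLli, fun h => hnot ?_⟩
    have hle : Submodule.span k (Set.range L) ≤ (Ideal.span (Set.range L)).restrictScalars k :=
      Submodule.span_le.mpr Ideal.subset_span
    exact hle h
  have hhom' := isHomogeneous_one_snoc hLhom hlam
  have ht : c + 1 ≤ d + 1 := by omega
  -- `i η` lies on the plane `V₊(L, λ)`, with the dimension of its generic point: it IS the generic point
  have hmem : i.left.base η ∈ ProjectiveSpectrum.zeroLocus (homogeneousSubmodule (Fin (d + 1 + 1)) k)
      (Set.range (Fin.snoc (α := fun _ => MvPolynomial (Fin (d + 1 + 1)) k) L lam)) := by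
    rintro _ ⟨j, rfl⟩
    refine Fin.lastCases ?_ (fun j' => ?_) j
    · rw [Fin.snoc_last]; exact hlamη
    · rw [Fin.snoc_castSucc]; exact hLη j'
  have hiη : height (i.left.base η) = 2 := by
    rw [height_base_eq_of_isClosedImmersion']; exact hη2
  have heq : i.left.base η = linearSubspacePoint (Fin.snoc L lam) hind hhom' ht := by
    by_contra hne
    have hlt := height_lt_of_mem_zeroLocus (Fin.snoc L lam) hind hhom' ht hmem hne
    rw [hiη, show d + 1 - (c + 1) = 2 by omega] at hlt
    exact lt_irrefl _ hlt
  -- hence `q ∈ (L, λ)` vanishes on the plane, and `λ` vanishes on `M`: contradiction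
  have hideal : (ProjectiveSpectrum.asHomogeneousIdeal
      (𝒜 := homogeneousSubmodule (Fin (d + 1 + 1)) k) (i.left.base η)).toIdeal =
        Ideal.span (Set.range (Fin.snoc (α := fun _ => MvPolynomial (Fin (d + 1 + 1)) k) L lam)) := by
    rw [heq]; exact toIdeal_linearSubspacePoint (Fin.snoc L lam) hind hhom' ht
  have hqmem : q ∈ Ideal.span (Set.range (Fin.snoc (α := fun _ => MvPolynomial (Fin (d + 1 + 1)) k) L lam)) := by
    rw [← hideal]; exact hqη
  have hqvan : ∀ v ∈ M, eval v lam = 0 → eval v q = 0 := by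
    intro v hv hvlam
    refine eval_eq_zero_of_mem_idealSpan_of_forall (fun j => ?_) hqmem
    refine Fin.lastCases ?_ (fun j' => ?_) j
    · rw [Fin.snoc_last]; exact hvlam
    · rw [Fin.snoc_castSucc]; exact ((hLM v).2 hv) j'
  exact hv₀ (hnoplane lam hlam hqvan v₀ hv₀M)

end NoPlane

/-! ### The residual-line family -/

section Residual

variable {k : Type u} [Field k] {K : Type*} [Field K] [Algebra k K] {N : ℕ}

/-- Two vectors separated by two linear functionals are independent. [folklore] -/
theorem linearIndependent_pair_of_linearMap {V : Type*} [AddCommGroup V] [Module K V]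
    (φ ψ : V →ₗ[K] K) {x y : V} (hφx : φ x ≠ 0) (hφy : φ y = 0) (hψx : ψ x = 0) (hψy : ψ y ≠ 0) :
    LinearIndependent K ![x, y] := by
  refine LinearIndependent.pair_iff.2 fun s t hst => ⟨?_, ?_⟩
  · have h := congrArg φ hst
    rw [map_add, map_smul, map_smul, hφy, smul_zero, add_zero, map_zero, smul_eq_mul] at h
    exact (mul_eq_zero.1 h).resolve_right hφx
  · have h := congrArg ψ hst
    rw [map_add, map_smul, map_smul, hψx, smul_zero, zero_add, map_zero, smul_eq_mul] at h
    exact (mul_eq_zero.1 h).resolve_right hψy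

/-- `Set.range ![n a, n b, n c] = n '' {a, b, c}`. [folklore] -/
theorem range_vec3_eq_image {V : Type*} {ι : Type*} (n : ι → V) (a b c : ι) :
    Set.range ![n a, n b, n c] = n '' {a, b, c} := by
  ext v
  simp only [Matrix.range_cons, Matrix.range_empty, Set.union_empty, Set.mem_union,
    Set.mem_insert_iff, Set.mem_singleton_iff, Set.image_insert_eq, Set.image_singleton]

/-- **Specialising the residual line.** Let `q` be a quadratic form over `k` (`2 ≠ 0`), `(a, b, y, w)`
vectors with `q ≡ 0` on `span(a, b)`, `ι : k → K` and `τ ∈ K` transcendental. Over `K` put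
`z = y + τ w`, `A = B(a, z)`, `B' = B(b, z)`, `C = q(z)` and `P₁ = -B' a + A b`, `P₂ = -C a + A z`
(two points spanning the residual line `l_τ` of `span(a, b, z) ∩ V(q)`). If a form `G` over `k`
vanishes on `span_K(P₁, P₂)`, then `G` vanishes at the points
`-(v B(b, z_t) + g q(z_t)) a + v B(a, z_t) b + g B(a, z_t) z_t`, `z_t = y + t w`, for all
`v, g, t ∈ k` (the residual lines `l_t`). [folklore] -/
theorem forall_eval_residual_eq_zero (h2 : (2 : k) ≠ 0) {τ : K} (hτ : Transcendental k τ)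
    {q : MvPolynomial (Fin (N + 1)) k} (hq : q.IsHomogeneous 2) (a b y w : Fin (N + 1) → k)
    {G : MvPolynomial (Fin (N + 1)) k}
    (hG : ∀ s t : K,
      eval (s • ((-(qpolar (MvPolynomial.map (algebraMap k K) q) (fun j => algebraMap k K (b j))
          ((fun j => algebraMap k K (y j)) + τ • (fun j => algebraMap k K (w j))))) •
            (fun j => algebraMap k K (a j)) +
          (qpolar (MvPolynomial.map (algebraMap k K) q) (fun j => algebraMap k K (a j))
            ((fun j => algebraMap k K (y j)) + τ • (fun j => algebraMap k K (w j)))) •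
            (fun j => algebraMap k K (b j))) +
        t • ((-(eval ((fun j => algebraMap k K (y j)) + τ • (fun j => algebraMap k K (w j)))
            (MvPolynomial.map (algebraMap k K) q))) • (fun j => algebraMap k K (a j)) +
          (qpolar (MvPolynomial.map (algebraMap k K) q) (fun j => algebraMap k K (a j))
            ((fun j => algebraMap k K (y j)) + τ • (fun j => algebraMap k K (w j)))) •
            ((fun j => algebraMap k K (y j)) + τ • (fun j => algebraMap k K (w j)))))
        (MvPolynomial.map (algebraMap k K) G) = 0)
    (v g t : k) :
    eval ((-(v * (qpolar q b y + t * qpolar q b w) + g * (eval y q + t * qpolar q y w + t ^ 2 * eval w q))) • a +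
      (v * (qpolar q a y + t * qpolar q a w)) • b +
        (g * (qpolar q a y + t * qpolar q a w)) • (y + t • w)) G = 0 := by
  set ι := algebraMap k K with hι
  have h2K : (2 : K) ≠ 0 := by rw [← map_ofNat ι 2]; exact (map_ne_zero ι).2 h2
  have hqK : (MvPolynomial.map ι q).IsHomogeneous 2 := hq.map ι
  -- the path `t ↦ P_t` as a polynomial path of degree `2`
  let V₀ : Fin (N + 1) → k := (-(v * qpolar q b y + g * eval y q)) • a + (v * qpolar q a y) • b +
    (g * qpolar q a y) • y
  let V₁ : Fin (N + 1) → k := (-(v * qpolar q b w + g * qpolar q y w)) • a + (v * qpolar q a w) • b +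
    (g * qpolar q a w) • y + (g * qpolar q a y) • w
  let V₂ : Fin (N + 1) → k := (-(g * eval w q)) • a + (g * qpolar q a w) • w
  let γ : Fin (N + 1) → Polynomial k := fun j =>
    Polynomial.C (V₀ j) + Polynomial.C (V₁ j) * Polynomial.X + Polynomial.C (V₂ j) * Polynomial.X ^ 2
  -- the `K`-quantities
  have hA : qpolar (MvPolynomial.map ι q) (fun j => ι (a j)) ((fun j => ι (y j)) + τ • (fun j => ι (w j))) =
      ι (qpolar q a y) + τ * ι (qpolar q a w) := by
    rw [qpolar_add_right, qpolar_smul_right, qpolar_map, qpolar_map]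
  have hB : qpolar (MvPolynomial.map ι q) (fun j => ι (b j)) ((fun j => ι (y j)) + τ • (fun j => ι (w j))) =
      ι (qpolar q b y) + τ * ι (qpolar q b w) := by
    rw [qpolar_add_right, qpolar_smul_right, qpolar_map, qpolar_map]
  have hC : eval ((fun j => ι (y j)) + τ • (fun j => ι (w j))) (MvPolynomial.map ι q) =
      ι (eval y q) + τ * ι (qpolar q y w) + τ ^ 2 * ι (eval w q) := by
    have h := eval_add_smul_smul_eq hqK h2K 1 τ (fun j => ι (y j)) (fun j => ι (w j))
    rw [one_smul] at h
    rw [h, IsCrSystem.eval_map_algebraMap, IsCrSystem.eval_map_algebraMap, qpolar_map]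
    ring
  have hpath : eval (fun j => Polynomial.aeval τ (γ j)) (MvPolynomial.map ι G) = 0 := by
    have h := hG (ι v) (ι g)
    rw [hA, hB, hC] at h
    have hpt : (fun j => Polynomial.aeval τ (γ j)) =
        ι v • ((-(ι (qpolar q b y) + τ * ι (qpolar q b w))) • (fun j => ι (a j)) +
            (ι (qpolar q a y) + τ * ι (qpolar q a w)) • (fun j => ι (b j))) +
          ι g • ((-(ι (eval y q) + τ * ι (qpolar q y w) + τ ^ 2 * ι (eval w q))) • (fun j => ι (a j)) +
            (ι (qpolar q a y) + τ * ι (qpolar q a w)) • ((fun j => ι (y j)) + τ • (fun j => ι (w j)))) := by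
      funext j
      simp only [γ, V₀, V₁, V₂, map_add, map_mul, Polynomial.aeval_C, Polynomial.aeval_X, map_pow,
        Pi.add_apply, Pi.smul_apply, smul_eq_mul, map_neg]
      ring
    rw [hpt]
    exact h
  have h := eval_path_eq_zero_of_transcendental hτ G γ hpath t
  have hpt : (-(v * (qpolar q b y + t * qpolar q b w) + g * (eval y q + t * qpolar q y w + t ^ 2 * eval w q))) • a +
      (v * (qpolar q a y + t * qpolar q a w)) • b +
        (g * (qpolar q a y + t * qpolar q a w)) • (y + t • w) = fun j => (γ j).eval t := by
    funext j
    simp only [γ, V₀, V₁, V₂, Polynomial.eval_add, Polynomial.eval_mul, Polynomial.eval_C,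
      Polynomial.eval_X, Polynomial.eval_pow, Pi.add_apply, Pi.smul_apply, smul_eq_mul]
    ring
  rw [hpt]
  exact h

/-- **The residual lines sweep the quadric.** With `q ≡ 0` on `span(a, b)`, a linear form `λ_y`
vanishing at `a, b, w`, and a form `G` vanishing at all the points of `forall_eval_residual_eq_zero`:
`G · λ_a · λ_y` (`λ_a = B(a, ·)`) vanishes at every zero of `q` in `span(a, b, y, w)` — a zero `P`
with `λ_a(P) ≠ 0`, `λ_y(P) ≠ 0` lies on a residual line `l_t`. [folklore] -/
theorem eval_mul_mul_eq_zero_of_residual (h2 : (2 : k) ≠ 0) {q : MvPolynomial (Fin (N + 1)) k}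
    (hq : q.IsHomogeneous 2) (n : Fin 4 → Fin (N + 1) → k)
    (hl₀ : ∀ s t : k, eval (s • n 0 + t • n 1) q = 0)
    {lamy : MvPolynomial (Fin (N + 1)) k} (hlamy : lamy.IsHomogeneous 1) (hly0 : eval (n 0) lamy = 0)
    (hly1 : eval (n 1) lamy = 0) (hly3 : eval (n 3) lamy = 0)
    {G : MvPolynomial (Fin (N + 1)) k}
    (hG : ∀ v g t : k, eval ((-(v * (qpolar q (n 1) (n 2) + t * qpolar q (n 1) (n 3)) +
        g * (eval (n 2) q + t * qpolar q (n 2) (n 3) + t ^ 2 * eval (n 3) q))) • n 0 +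
      (v * (qpolar q (n 0) (n 2) + t * qpolar q (n 0) (n 3))) • n 1 +
        (g * (qpolar q (n 0) (n 2) + t * qpolar q (n 0) (n 3))) • (n 2 + t • n 3)) G = 0)
    {P : Fin (N + 1) → k} (hP : P ∈ Submodule.span k (Set.range n)) (hqP : eval P q = 0) :
    eval P (G * (lin (hessian q *ᵥ n 0) * lamy)) = 0 := by
  classical
  obtain ⟨cf, rfl⟩ := (Submodule.mem_span_range_iff_exists_fun k).1 hP
  have hBaa : qpolar q (n 0) (n 0) = 0 := by
    have h := two_mul_eval_eq_qpolar hq (n 0)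
    have h0 : eval (n 0) q = 0 := by simpa using hl₀ 1 0
    rw [h0, mul_zero] at h
    exact h.symm
  have hBab : qpolar q (n 0) (n 1) = 0 := qpolar_eq_zero_of_isotropic hq h2 hl₀
  obtain ⟨φy, hφy⟩ := exists_linearMap_forall_eval_eq hlamy
  have hsum : ∑ c, cf c • n c = cf 0 • n 0 + cf 1 • n 1 + cf 2 • n 2 + cf 3 • n 3 := Fin.sum_univ_four _
  rw [map_mul, map_mul, eval_lin_hessian_mulVec]
  -- `λ_a(P) = γ₁ B(a, y) + γ₂ B(a, w)`, `λ_y(P) = γ₁ λ_y(y)`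
  have hla : qpolar q (n 0) (∑ c, cf c • n c) = cf 2 * qpolar q (n 0) (n 2) + cf 3 * qpolar q (n 0) (n 3) := by
    rw [hsum, qpolar_add_right, qpolar_add_right, qpolar_add_right, qpolar_smul_right, qpolar_smul_right,
      qpolar_smul_right, qpolar_smul_right, hBaa, hBab, mul_zero, mul_zero, zero_add, zero_add]
  have hly : eval (∑ c, cf c • n c) lamy = cf 2 * eval (n 2) lamy := by
    rw [hsum, hφy, map_add, map_add, map_add, map_smul, map_smul, map_smul, map_smul, ← hφy, ← hφy,
      ← hφy, ← hφy, hly0, hly1, hly3, smul_zero, smul_zero, smul_zero, zero_add, zero_add, add_zero,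
      smul_eq_mul]
  by_cases hc2 : cf 2 = 0
  · rw [hly, hc2, zero_mul, mul_zero, mul_zero]
  by_cases hA0 : cf 2 * qpolar q (n 0) (n 2) + cf 3 * qpolar q (n 0) (n 3) = 0
  · rw [hla, hA0, zero_mul, mul_zero]
  -- `P` lies on the residual line `l_t`, `t = γ₂ / γ₁`
  set t := cf 3 / cf 2 with ht
  set A₀ := qpolar q (n 0) (n 2) + t * qpolar q (n 0) (n 3) with hA₀
  set B₀ := qpolar q (n 1) (n 2) + t * qpolar q (n 1) (n 3) with hB₀
  set C₀ := eval (n 2) q + t * qpolar q (n 2) (n 3) + t ^ 2 * eval (n 3) q with hC₀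
  have hA₀0 : A₀ ≠ 0 := by
    intro h0
    apply hA0
    have h : cf 2 * A₀ = 0 := by rw [h0, mul_zero]
    rw [hA₀, mul_add, ← mul_assoc, mul_div_cancel₀ _ hc2] at h
    exact h
  have hPt : ∑ c, cf c • n c = (cf 0 • n 0 + cf 1 • n 1) + cf 2 • (n 2 + t • n 3) := by
    rw [hsum, smul_add, smul_smul, mul_div_cancel₀ _ hc2]
    abel
  -- the relation `α A₀ + β B₀ + γ₁ C₀ = 0` from `q(P) = 0`
  have hz : qpolar q (n 0) (n 2 + t • n 3) = A₀ := by
    rw [hA₀, qpolar_add_right, qpolar_smul_right]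
  have hz' : qpolar q (n 1) (n 2 + t • n 3) = B₀ := by
    rw [hB₀, qpolar_add_right, qpolar_smul_right]
  have hz'' : eval (n 2 + t • n 3) q = C₀ := by
    have h := eval_add_smul_smul_eq hq h2 1 t (n 2) (n 3)
    rw [one_smul] at h
    rw [hC₀, h]; ring
  have hrel : cf 0 * A₀ + cf 1 * B₀ + cf 2 * C₀ = 0 := by
    have h := hqP
    rw [hPt, eval_add_eq_qpolar hq h2, hl₀, zero_add, qpolar_smul_right, qpolar_add_left, qpolar_smul_left,
      qpolar_smul_left, hz, hz', eval_smul_eq_sq_mul hq h2, hz''] at h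
    have h' : cf 2 * (cf 0 * A₀ + cf 1 * B₀ + cf 2 * C₀) = 0 := by rw [← h]; ring
    exact (mul_eq_zero.1 h').resolve_left hc2
  -- `P = P_t(v, g)` with `v = β / A₀`, `g = γ₁ / A₀`
  clear_value t A₀ B₀ C₀
  have hG' := hG (cf 1 / A₀) (cf 2 / A₀) t
  rw [← hA₀, ← hB₀, ← hC₀] at hG'
  have hcoef : -(cf 1 / A₀ * B₀ + cf 2 / A₀ * C₀) = cf 0 := by
    rw [div_mul_eq_mul_div, div_mul_eq_mul_div, ← add_div, ← neg_div, div_eq_iff hA₀0]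
    linear_combination -hrel
  rw [hcoef, div_mul_cancel₀ _ hA₀0, div_mul_cancel₀ _ hA₀0, ← hPt] at hG'
  rw [hG', zero_mul]

end Residual

/-! ### The main construction -/

section Core

variable {k : Type u} [Field k] [IsAlgClosed k] {d : ℕ} (X : SchemeOver k)
  (i : X ⟶ projectiveSpace (d + 1) k) [IsClosedImmersion i.left]

/-- **The residual-line family of a quadric surface, from an adapted frame.** Core of
`isLineSweptPoint_of_mem_quadricSurface`: the frame `(a, b, y, w)` of `M = V₊(L)` has `q ≡ 0` on
`span(a, b)` (a line `l₀ ⊆ Q`) and `B(a, y) ≠ 0` or `B(a, w) ≠ 0` (the tangent form `λ_a` of `Q` at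
`a` is not identically zero on `M`). [cite: Mboro2018, proof of Prop. 1.4 (arXiv:1701.04488, p. 8)] -/
theorem isLineSweptPoint_of_mem_quadricSurface_of_frame (h2 : (2 : k) ≠ 0) {c : ℕ} (hc : c + 3 = d + 1)
    (L : Fin c → MvPolynomial (Fin (d + 1 + 1)) k) (hLhom : ∀ j, (L j).IsHomogeneous 1)
    (hLli : LinearIndependent k L)
    (n : Fin 4 → Fin (d + 1 + 1) → k) (hn : LinearIndependent k n)
    (hLM : ∀ P : Fin (d + 1 + 1) → k, (∀ j, eval P (L j) = 0) ↔ P ∈ Submodule.span k (Set.range n))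
    {q : MvPolynomial (Fin (d + 1 + 1)) k} (hq : q.IsHomogeneous 2)
    (hl₀ : ∀ s t : k, eval (s • n 0 + t • n 1) q = 0)
    (hA : qpolar q (n 0) (n 2) ≠ 0 ∨ qpolar q (n 0) (n 3) ≠ 0)
    (hnoplane : ∀ lam : MvPolynomial (Fin (d + 1 + 1)) k, lam.IsHomogeneous 1 →
      (∀ v ∈ Submodule.span k (Set.range n), eval v lam = 0 → eval v q = 0) →
        ∀ v ∈ Submodule.span k (Set.range n), eval v lam = 0)
    (hQX : ProjectiveSpectrum.zeroLocus (homogeneousSubmodule (Fin (d + 1 + 1)) k)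
      (insert q (Set.range L)) ⊆ Set.range i.left.base)
    {η : ↥X.left} (hη2 : height η = 2)
    (hqη : q ∈ ProjectiveSpectrum.asHomogeneousIdeal
      (𝒜 := homogeneousSubmodule (Fin (d + 1 + 1)) k) (i.left.base η))
    (hLη : ∀ j, L j ∈ ProjectiveSpectrum.asHomogeneousIdeal
      (𝒜 := homogeneousSubmodule (Fin (d + 1 + 1)) k) (i.left.base η)) :
    IsLineSweptPoint i η := by
  classical
  set M := Submodule.span k (Set.range n) with hM
  have hMvan : ∀ j, ∀ v ∈ M, eval v (L j) = 0 := fun j v hv => ((hLM v).2 hv) j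
  have hnmem : ∀ c', n c' ∈ M := fun c' => Submodule.subset_span ⟨c', rfl⟩
  have noPlane := fun lam hlam hlamη =>
    forall_eval_eq_zero_of_linear_mem X i hc L hLhom hLli M hLM hnoplane hη2 hqη hLη (lam := lam) hlam hlamη
  -- dual forms `λ_b`, `λ_y`
  have h023 : LinearIndependent k ![n 0, n 2, n 3] := by
    have h := hn.comp ![(0 : Fin 4), 2, 3] (by decide)
    convert h using 1
    funext a; fin_cases a <;> rfl
  have h1 : n 1 ∉ Submodule.span k (Set.range ![n 0, n 2, n 3]) := by
    rw [range_vec3_eq_image]; exact hn.notMem_span_image (s := {0, 2, 3}) (x := 1) (by decide)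
  obtain ⟨lamb, hlambhom, hlambvan, hlambb⟩ := exists_linearForm_vanishing_eval_ne_zero h023 h1
  have hlb0 : eval (n 0) lamb = 0 := hlambvan _ (Submodule.subset_span ⟨0, rfl⟩)
  have hlb2 : eval (n 2) lamb = 0 := hlambvan _ (Submodule.subset_span ⟨1, rfl⟩)
  have hlb3 : eval (n 3) lamb = 0 := hlambvan _ (Submodule.subset_span ⟨2, rfl⟩)
  have h013 : LinearIndependent k ![n 0, n 1, n 3] := by
    have h := hn.comp ![(0 : Fin 4), 1, 3] (by decide)
    convert h using 1
    funext a; fin_cases a <;> rfl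
  have h2' : n 2 ∉ Submodule.span k (Set.range ![n 0, n 1, n 3]) := by
    rw [range_vec3_eq_image]; exact hn.notMem_span_image (s := {0, 1, 3}) (x := 2) (by decide)
  obtain ⟨lamy, hlamyhom, hlamyvan, hlamyy⟩ := exists_linearForm_vanishing_eval_ne_zero h013 h2'
  have hly0 : eval (n 0) lamy = 0 := hlamyvan _ (Submodule.subset_span ⟨0, rfl⟩)
  have hly1 : eval (n 1) lamy = 0 := hlamyvan _ (Submodule.subset_span ⟨1, rfl⟩)
  have hly3 : eval (n 3) lamy = 0 := hlamyvan _ (Submodule.subset_span ⟨2, rfl⟩)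
  -- the curve `B`, `K = k(B)`, `τ` transcendental
  obtain ⟨B, _, _, hB1, htr, hpid⟩ := exists_regularProperCurve k
  set K := B.left.functionField with hK
  obtain ⟨τ, hτ⟩ := exists_transcendental_of_trdeg_eq_one htr
  let ι : k →+* K := algebraMap k K
  haveI : Infinite K := Infinite.of_injective ι ι.injective
  have h2K : (2 : K) ≠ 0 := by rw [← map_ofNat ι 2]; exact (map_ne_zero ι).2 h2
  set qK := MvPolynomial.map ι q with hqKdef
  have hqK : qK.IsHomogeneous 2 := hq.map ι
  -- the `K`-vectors
  set a' : Fin (d + 1 + 1) → K := fun j => ι (n 0 j) with ha'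
  set b' : Fin (d + 1 + 1) → K := fun j => ι (n 1 j) with hb'
  set y' : Fin (d + 1 + 1) → K := fun j => ι (n 2 j) with hy'
  set w' : Fin (d + 1 + 1) → K := fun j => ι (n 3 j) with hw'
  set z' : Fin (d + 1 + 1) → K := y' + τ • w' with hz'
  set A : K := qpolar qK a' z' with hAdef
  set Bf : K := qpolar qK b' z' with hBfdef
  set C : K := eval z' qK with hCdef
  have hAval : A = ι (qpolar q (n 0) (n 2)) + τ * ι (qpolar q (n 0) (n 3)) := by
    rw [hAdef, hz', qpolar_add_right, qpolar_smul_right, ha', hy', hw', hqKdef, qpolar_map, qpolar_map]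
  have hA0 : A ≠ 0 := by rw [hAval]; exact algebraMap_add_mul_ne_zero_of_transcendental hτ hA
  set P₁ : Fin (d + 1 + 1) → K := (-Bf) • a' + A • b' with hP₁
  set P₂ : Fin (d + 1 + 1) → K := (-C) • a' + A • z' with hP₂
  -- `P₁, P₂` are independent
  obtain ⟨φb, hφb⟩ := exists_linearMap_forall_eval_eq (hlambhom.map ι)
  obtain ⟨φy, hφy⟩ := exists_linearMap_forall_eval_eq (hlamyhom.map ι)
  have vb0 : φb a' = 0 := by rw [← hφb, ha', IsCrSystem.eval_map_algebraMap, hlb0, map_zero]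
  have vb1 : φb b' = ι (eval (n 1) lamb) := by rw [← hφb, hb', IsCrSystem.eval_map_algebraMap]
  have vb2 : φb y' = 0 := by rw [← hφb, hy', IsCrSystem.eval_map_algebraMap, hlb2, map_zero]
  have vb3 : φb w' = 0 := by rw [← hφb, hw', IsCrSystem.eval_map_algebraMap, hlb3, map_zero]
  have vy0 : φy a' = 0 := by rw [← hφy, ha', IsCrSystem.eval_map_algebraMap, hly0, map_zero]
  have vy1 : φy b' = 0 := by rw [← hφy, hb', IsCrSystem.eval_map_algebraMap, hly1, map_zero]
  have vy2 : φy y' = ι (eval (n 2) lamy) := by rw [← hφy, hy', IsCrSystem.eval_map_algebraMap]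
  have vy3 : φy w' = 0 := by rw [← hφy, hw', IsCrSystem.eval_map_algebraMap, hly3, map_zero]
  have hP : LinearIndependent K ![P₁, P₂] := by
    refine linearIndependent_pair_of_linearMap φb φy ?_ ?_ ?_ ?_
    · rw [hP₁, map_add, map_smul, map_smul, vb0, vb1, smul_zero, zero_add, smul_eq_mul]
      exact mul_ne_zero hA0 ((map_ne_zero ι).2 hlambb)
    · rw [hP₂, hz', map_add, map_smul, map_smul, map_add, map_smul, vb0, vb2, vb3, smul_zero, smul_zero,
        add_zero, smul_zero, add_zero]
    · rw [hP₁, map_add, map_smul, map_smul, vy0, vy1, smul_zero, smul_zero, add_zero]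
    · rw [hP₂, hz', map_add, map_smul, map_smul, map_add, map_smul, vy0, vy2, vy3, smul_zero, zero_add,
        smul_zero, add_zero, smul_eq_mul]
      exact mul_ne_zero hA0 ((map_ne_zero ι).2 hlamyy)
  -- the line `l_τ = span(P₁, P₂)` and its forms `μ`
  obtain ⟨μ, hμli, hμhom, hμv, hμideal⟩ := exists_lineForms ![P₁, P₂] hP (by omega : 1 ≤ d + 1)
  have hvanμ : ∀ G ∈ Ideal.span (Set.range μ), ∀ s t : K, eval (s • P₁ + t • P₂) G = 0 := by
    intro G hG s t
    refine eval_eq_zero_of_mem_idealSpan_of_forall (fun l => ?_) hG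
    rw [eval_add_smul_of_isHomogeneous_one (hμhom l)]
    have h0 : eval P₁ (μ l) = 0 := hμv l 0
    have h1 : eval P₂ (μ l) = 0 := hμv l 1
    rw [h0, h1, mul_zero, mul_zero, add_zero]
  -- points of `l_τ` are combinations of `a', b', z'`, on `Q_K` and on `M_K`
  have hcomb : ∀ s t : K, s • P₁ + t • P₂ = ((-(s * Bf + t * C)) • a' + (s * A) • b') + (t * A) • z' := by
    intro s t
    rw [hP₁, hP₂]
    funext j
    simp only [Pi.add_apply, Pi.smul_apply, smul_eq_mul, neg_mul]
    ring
  have hspanK : ∀ s t : K, s • P₁ + t • P₂ ∈ Submodule.span K (Set.range fun c' j => ι (n c' j)) := by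
    intro s t
    rw [hcomb, hz']
    refine Submodule.add_mem _ (Submodule.add_mem _ (Submodule.smul_mem _ _ (Submodule.subset_span ⟨0, rfl⟩))
      (Submodule.smul_mem _ _ (Submodule.subset_span ⟨1, rfl⟩))) (Submodule.smul_mem _ _ ?_)
    exact Submodule.add_mem _ (Submodule.subset_span ⟨2, rfl⟩)
      (Submodule.smul_mem _ _ (Submodule.subset_span ⟨3, rfl⟩))
  have hqa' : eval a' qK = 0 := by
    rw [ha', hqKdef, IsCrSystem.eval_map_algebraMap]; simpa using congrArg ι (hl₀ 1 0)
  have hqb' : eval b' qK = 0 := by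
    rw [hb', hqKdef, IsCrSystem.eval_map_algebraMap]; simpa using congrArg ι (hl₀ 0 1)
  have hab' : qpolar qK a' b' = 0 := by
    rw [ha', hb', hqKdef, qpolar_map, qpolar_eq_zero_of_isotropic hq h2 hl₀, map_zero]
  have hQl : ∀ s t : K, eval (s • P₁ + t • P₂) qK = 0 := by
    intro s t
    rw [hcomb, eval_add_eq_qpolar hqK h2K, eval_add_smul_smul_eq hqK h2K, hqa', hqb', hab',
      qpolar_smul_right, qpolar_add_left, qpolar_smul_left, qpolar_smul_left, ← hAdef, ← hBfdef,
      eval_smul_eq_sq_mul hqK h2K, ← hCdef]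
    ring
  have hLl : ∀ j, ∀ s t : K, eval (s • P₁ + t • P₂) (MvPolynomial.map ι (L j)) = 0 := by
    intro j s t
    refine forall_mem_span_eval_eq_zero_of_isHomogeneous_one ((hLhom j).map ι) ?_ _ (hspanK s t)
    rintro _ ⟨c', rfl⟩
    rw [IsCrSystem.eval_map_algebraMap, hMvan j _ (hnmem c'), map_zero]
  have hqμ : qK ∈ Ideal.span (Set.range μ) := hμideal _ hQl
  have hLμ : ∀ j, MvPolynomial.map ι (L j) ∈ Ideal.span (Set.range μ) := fun j => hμideal _ (hLl j)
  set lamK := linearSubspacePoint μ hμli hμhom (Nat.sub_le (d + 1) 1) with hlamK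
  -- membership in `𝔭_{π(l_τ)}`
  have hmemπ : ∀ G : MvPolynomial (Fin (d + 1 + 1)) k,
      G ∈ ProjectiveSpectrum.asHomogeneousIdeal (𝒜 := homogeneousSubmodule (Fin (d + 1 + 1)) k)
        (projMap (d := d + 1) k K lamK) ↔ MvPolynomial.map ι G ∈ Ideal.span (Set.range μ) := by
    intro G
    rw [mem_asHomogeneousIdeal_projMap_iff, ← HomogeneousIdeal.mem_iff, hlamK, toIdeal_linearSubspacePoint]
  -- `π(l_τ)` lies on `Q ⊆ X`
  have hmemX : projMap (d := d + 1) k K lamK ∈ Set.range i.left.base := by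
    refine hQX ?_
    rintro G hG
    rcases hG with rfl | ⟨j, rfl⟩
    · exact (hmemπ _).2 hqμ
    · exact (hmemπ _).2 (hLμ j)
  obtain ⟨yQ, hyQ, hls⟩ := exists_point_of_fibre_line X i B hB1 htr hpid μ hμli hμhom hmemX
  -- KEY: homogeneous forms vanishing on `l_τ` lie in `𝔭_η`
  have key : ∀ G : MvPolynomial (Fin (d + 1 + 1)) k, SetLike.IsHomogeneousElem
      (homogeneousSubmodule (Fin (d + 1 + 1)) k) G → MvPolynomial.map ι G ∈ Ideal.span (Set.range μ) →
      G ∈ ProjectiveSpectrum.asHomogeneousIdeal (𝒜 := homogeneousSubmodule (Fin (d + 1 + 1)) k)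
        (i.left.base η) := by
    rintro G ⟨e, he⟩ hG
    have hGhom : G.IsHomogeneous e := (mem_homogeneousSubmodule e G).1 he
    rcases Nat.eq_zero_or_pos e with rfl | hepos
    · -- constants: `G = C c`, and `c = 0` since `(μ)` is proper
      have hGC : G = MvPolynomial.C (coeff 0 G) :=
        totalDegree_eq_zero_iff_eq_C.1 ((totalDegree_zero_iff_isHomogeneous _).2 hGhom)
      by_cases hc0 : coeff 0 G = 0
      · rw [hGC, hc0, map_zero]; exact zero_mem _
      · exfalso
        have hunit : IsUnit (MvPolynomial.map ι G) := by
          rw [hGC, MvPolynomial.map_C]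
          exact (isUnit_iff_ne_zero.2 ((map_ne_zero ι).2 hc0)).map MvPolynomial.C
        have htop : Ideal.span (Set.range μ) = ⊤ := Ideal.eq_top_of_isUnit_mem _ hG hunit
        have hne : (ProjectiveSpectrum.asHomogeneousIdeal
            (𝒜 := homogeneousSubmodule (Fin (d + 1 + 1)) K) lamK).toIdeal ≠ ⊤ := lamK.isPrime.ne_top
        rw [hlamK, toIdeal_linearSubspacePoint] at hne
        exact hne htop
    · -- (i) `G ⊗ 1` vanishes on `l_τ`; (ii) `G` vanishes on the residual lines `l_t`
      have hGl := hvanμ _ hG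
      have hGt := forall_eval_residual_eq_zero h2 hτ hq (n 0) (n 1) (n 2) (n 3) (G := G) (by
        intro s t
        have h := hGl s t
        rw [hP₁, hP₂, hAdef, hBfdef, hCdef, hz', ha', hb', hy', hw', hqKdef] at h
        exact h)
      -- (iii) `G λ_a λ_y` vanishes on `Q(k)`
      have hGZ := fun P (hPM : P ∈ M) (hqP : eval P q = 0) =>
        eval_mul_mul_eq_zero_of_residual h2 hq n hl₀ hlamyhom hly0 hly1 hly3 hGt hPM hqP
      -- (iv) Nullstellensatz
      set I : Ideal (MvPolynomial (Fin (d + 1 + 1)) k) := Ideal.span (insert q (Set.range L)) with hI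
      have hvan : G * (lin (hessian q *ᵥ n 0) * lamy) ∈
          MvPolynomial.vanishingIdeal k (MvPolynomial.zeroLocus k I) := by
        rw [MvPolynomial.mem_vanishingIdeal_iff]
        intro x hx
        rw [MvPolynomial.mem_zeroLocus_iff] at hx
        have hxq : eval x q = 0 := by
          have h := hx q (Ideal.subset_span (Set.mem_insert _ _))
          rwa [show aeval x q = eval x q from congrFun (MvPolynomial.aeval_eq_eval (f := x)) q] at h
        have hxL : ∀ j, eval x (L j) = 0 := by
          intro j
          have h := hx (L j) (Ideal.subset_span (Set.mem_insert_of_mem _ ⟨j, rfl⟩))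
          rwa [show aeval x (L j) = eval x (L j) from congrFun (MvPolynomial.aeval_eq_eval (f := x)) _] at h
        rw [show aeval x (G * (lin (hessian q *ᵥ n 0) * lamy)) = eval x (G * (lin (hessian q *ᵥ n 0) * lamy))
          from congrFun (MvPolynomial.aeval_eq_eval (f := x)) _]
        exact hGZ x ((hLM x).1 hxL) hxq
      rw [MvPolynomial.vanishingIdeal_zeroLocus_eq_radical] at hvan
      obtain ⟨N₀, hN₀⟩ := Ideal.mem_radical_iff.1 hvan
      have hIle : I ≤ (ProjectiveSpectrum.asHomogeneousIdeal (𝒜 := homogeneousSubmodule (Fin (d + 1 + 1)) k)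
          (i.left.base η)).toIdeal := by
        rw [hI, Ideal.span_le]
        rintro G' hG'
        rcases hG' with rfl | ⟨j, rfl⟩
        · exact hqη
        · exact hLη j
      have hprime := (i.left.base η).isPrime
      have hmem : G * (lin (hessian q *ᵥ n 0) * lamy) ∈ (ProjectiveSpectrum.asHomogeneousIdeal
          (𝒜 := homogeneousSubmodule (Fin (d + 1 + 1)) k) (i.left.base η)).toIdeal :=
        hprime.mem_of_pow_mem N₀ (hIle hN₀)
      -- (v) the linear factors are not in `𝔭_η`
      rcases hprime.mem_or_mem hmem with h | h
      · exact h
      · exfalso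
        rcases hprime.mem_or_mem h with h' | h'
        · have hzero := noPlane _ (isHomogeneous_lin _) h'
          have hy := hzero _ (hnmem 2)
          have hw := hzero _ (hnmem 3)
          rw [eval_lin_hessian_mulVec] at hy hw
          rcases hA with h0 | h0
          · exact h0 hy
          · exact h0 hw
        · exact hlamyy (noPlane _ hlamyhom h' _ (hnmem 2))
  -- `y_Q ⤳ η`
  have hspec : i.left.base yQ ⤳ i.left.base η := by
    rw [hyQ]
    refine specializes_iff_le.2 ?_
    rw [← (ProjectiveSpectrum.asHomogeneousIdeal (𝒜 := homogeneousSubmodule (Fin (d + 1 + 1)) k)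
      (projMap (d := d + 1) k K lamK)).isHomogeneous.toIdeal_homogeneousCore_eq_self]
    change Ideal.span _ ≤ _
    refine Ideal.span_le.2 ?_
    rintro _ ⟨⟨G, hGhom⟩, hGmem, rfl⟩
    exact key G hGhom ((hmemπ G).1 hGmem)
  -- `dim y_Q = 2`
  have hiη : height (i.left.base η) = 2 := by rw [height_base_eq_of_isClosedImmersion']; exact hη2
  have hge : (2 : ℕ∞) ≤ height (i.left.base yQ) := by
    rw [← hiη]
    exact Order.height_mono (Scheme.le_iff_specializes.2 hspec)
  have hqnot : q ∉ Ideal.span (Set.range L) := by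
    intro h
    have hqM : ∀ v ∈ M, eval v q = 0 := fun v hv =>
      eval_eq_zero_of_mem_idealSpan_of_forall (fun j => hMvan j v hv) h
    exact hlamyy (hnoplane lamy hlamyhom (fun v hv _ => hqM v hv) _ (hnmem 2))
  have hlt : height (i.left.base yQ) < ((d + 1 - c : ℕ) : ℕ∞) := by
    have hcle : c ≤ d + 1 := by omega
    refine height_lt_of_mem_zeroLocus L hLli hLhom hcle ?_ ?_
    · rintro _ ⟨j, rfl⟩
      rw [hyQ]
      exact (hmemπ _).2 (hLμ j)
    · intro heq
      apply hqnot
      rw [← toIdeal_linearSubspacePoint L hLli hLhom hcle, ← heq, hyQ]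
      exact (hmemπ _).2 hqμ
  rw [show d + 1 - c = 3 by omega] at hlt
  have hyQi2 : height (i.left.base yQ) = 2 := by
    have hne : height (i.left.base yQ) ≠ ⊤ := ne_top_of_lt hlt
    obtain ⟨m, hm⟩ := ENat.ne_top_iff_exists.1 hne
    rw [← hm] at hge hlt ⊢
    have h1 : (2 : ℕ) ≤ m := by exact_mod_cast hge
    have h2 : m < 3 := by exact_mod_cast hlt
    have h3 : m = 2 := by omega
    rw [h3]; rfl
  have hyQ2 : height yQ = 2 := by rw [← height_base_eq_of_isClosedImmersion' i.left]; exact hyQi2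
  have heqη : i.left.base yQ = i.left.base η :=
    eq_of_specializes_of_height_eq hspec (by rw [hiη, hyQi2]) (by rw [hyQi2]; exact WithTop.coe_lt_top _)
  have hyη : yQ = η := i.left.isClosedEmbedding.injective heqη
  rw [← hyη]
  exact hls hyQ2

end Core

/-! ### The theorem -/

section Main

variable {k : Type u} [Field k] [IsAlgClosed k] {d : ℕ} (X : SchemeOver k)
  (i : X ⟶ projectiveSpace (d + 1) k) [IsClosedImmersion i.left]

/-- **Quadric surfaces of `X` are line-swept.** Let `k` be algebraically closed with `2 ≠ 0`,
`X ⊆ ℙᵈ⁺¹_k` closed, `M = V₊(L₁, …, L_c)` a `3`-plane (`c + 3 = d + 1`, frame `m` of the cone `M̂`),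
and `q` a quadratic form such that `Q = M ∩ V₊(q)` lies on `X` and contains NO plane of `M` (a
linear form whose zero set in `M̂` lies in that of `q` vanishes on `M̂`). Then every point `η ∈ X`
of dimension `2` with `q, L ∈ 𝔭_η` is LINE-SWEPT: `Q` contains a line `l₀` (an isotropic plane of
`q` on `M̂`, `exists_isotropic_frame`), the planes `H ⊇ l₀` of `M` cut `Q` in `l₀` and a residual
line, and the residual lines over the abstract curve `B` (`K = k(B)`) form a `K`-line of `X_K`
specialising to `η` (`isLineSweptPoint_of_mem_quadricSurface_of_frame`). This is the ruling
argument of Mboro's proof of Prop. 1.4 ("`span(x, l₀) ∩ S` … the residual curve is a line passing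
through `x`") for the quadric component of a plane section `X ∩ M = Π ∪ Q`.
[cite: Mboro2018, proof of Prop. 1.4 (arXiv:1701.04488, p. 8)] [cite: Hartshorne1977, I Thm. 1.3A] -/
theorem isLineSweptPoint_of_mem_quadricSurface (h2 : (2 : k) ≠ 0) {c : ℕ} (hc : c + 3 = d + 1)
    (L : Fin c → MvPolynomial (Fin (d + 1 + 1)) k) (hLhom : ∀ j, (L j).IsHomogeneous 1)
    (hLli : LinearIndependent k L)
    (m : Fin 4 → Fin (d + 1 + 1) → k) (hm : LinearIndependent k m)
    (hLM : ∀ P : Fin (d + 1 + 1) → k, (∀ j, eval P (L j) = 0) ↔ P ∈ Submodule.span k (Set.range m))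
    {q : MvPolynomial (Fin (d + 1 + 1)) k} (hq : q.IsHomogeneous 2)
    (hnoplane : ∀ lam : MvPolynomial (Fin (d + 1 + 1)) k, lam.IsHomogeneous 1 →
      (∀ v ∈ Submodule.span k (Set.range m), eval v lam = 0 → eval v q = 0) →
        ∀ v ∈ Submodule.span k (Set.range m), eval v lam = 0)
    (hQX : ProjectiveSpectrum.zeroLocus (homogeneousSubmodule (Fin (d + 1 + 1)) k)
      (insert q (Set.range L)) ⊆ Set.range i.left.base)
    {η : ↥X.left} (hη2 : height η = 2)
    (hqη : q ∈ ProjectiveSpectrum.asHomogeneousIdeal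
      (𝒜 := homogeneousSubmodule (Fin (d + 1 + 1)) k) (i.left.base η))
    (hLη : ∀ j, L j ∈ ProjectiveSpectrum.asHomogeneousIdeal
      (𝒜 := homogeneousSubmodule (Fin (d + 1 + 1)) k) (i.left.base η)) :
    IsLineSweptPoint i η := by
  classical
  -- an isotropic frame `n` of `M̂`
  obtain ⟨n, hn, hnspan, hl₀⟩ := exists_isotropic_frame hq h2 m hm
  haveI : Module.Finite k (Submodule.span k (Set.range m)) :=
    FiniteDimensional.span_of_finite k (Set.finite_range m)
  have hspan : Submodule.span k (Set.range n) = Submodule.span k (Set.range m) := by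
    refine Submodule.eq_of_le_of_finrank_eq (Submodule.span_le.2 ?_) ?_
    · rintro _ ⟨c', rfl⟩; exact hnspan c'
    · rw [finrank_span_eq_card hn, finrank_span_eq_card hm]
  have hLM' : ∀ P : Fin (d + 1 + 1) → k, (∀ j, eval P (L j) = 0) ↔ P ∈ Submodule.span k (Set.range n) := by
    intro P; rw [hspan]; exact hLM P
  have hnoplane' : ∀ lam : MvPolynomial (Fin (d + 1 + 1)) k, lam.IsHomogeneous 1 →
      (∀ v ∈ Submodule.span k (Set.range n), eval v lam = 0 → eval v q = 0) →
        ∀ v ∈ Submodule.span k (Set.range n), eval v lam = 0 := by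
    rw [hspan]; exact hnoplane
  have hnmem : ∀ c', n c' ∈ Submodule.span k (Set.range n) := fun c' => Submodule.subset_span ⟨c', rfl⟩
  by_cases hA : qpolar q (n 0) (n 2) ≠ 0 ∨ qpolar q (n 0) (n 3) ≠ 0
  · exact isLineSweptPoint_of_mem_quadricSurface_of_frame X i h2 hc L hLhom hLli n hn hLM' hq hl₀ hA
      hnoplane' hQX hη2 hqη hLη
  by_cases hB : qpolar q (n 1) (n 2) ≠ 0 ∨ qpolar q (n 1) (n 3) ≠ 0
  · -- swap the roles of `a` and `b`
    let σ : Equiv.Perm (Fin 4) := Equiv.swap 0 1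
    have hσ0 : σ 0 = 1 := Equiv.swap_apply_left 0 1
    have hσ1 : σ 1 = 0 := Equiv.swap_apply_right 0 1
    have hσ2 : σ 2 = 2 := Equiv.swap_apply_of_ne_of_ne (by decide) (by decide)
    have hσ3 : σ 3 = 3 := Equiv.swap_apply_of_ne_of_ne (by decide) (by decide)
    have hrange : Set.range (n ∘ σ) = Set.range n := σ.surjective.range_comp n
    have hn' : LinearIndependent k (n ∘ σ) := hn.comp σ σ.injective
    refine isLineSweptPoint_of_mem_quadricSurface_of_frame X i h2 hc L hLhom hLli (n ∘ σ) hn'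
      (by rw [hrange]; exact hLM') hq ?_ ?_ (by rw [hrange]; exact hnoplane') hQX hη2 hqη hLη
    · intro s t
      change eval (s • n (σ 0) + t • n (σ 1)) q = 0
      rw [hσ0, hσ1, add_comm (s • n 1)]
      exact hl₀ t s
    · change qpolar q (n (σ 0)) (n (σ 2)) ≠ 0 ∨ qpolar q (n (σ 0)) (n (σ 3)) ≠ 0
      rw [hσ0, hσ2, hσ3]
      exact hB
  -- degenerate case: `q` restricted to `M̂` is the binary form `q(γ₁ y + γ₂ w)`, so `Q` contains a plane
  exfalso
  push Not at hA hB
  obtain ⟨hA2, hA3⟩ := hA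
  obtain ⟨hB2, hB3⟩ := hB
  have hBaa : qpolar q (n 0) (n 0) = 0 := by
    have h := two_mul_eval_eq_qpolar hq (n 0)
    have h0 : eval (n 0) q = 0 := by simpa using hl₀ 1 0
    rw [h0, mul_zero] at h; exact h.symm
  have hBbb : qpolar q (n 1) (n 1) = 0 := by
    have h := two_mul_eval_eq_qpolar hq (n 1)
    have h0 : eval (n 1) q = 0 := by simpa using hl₀ 0 1
    rw [h0, mul_zero] at h; exact h.symm
  have hBab : qpolar q (n 0) (n 1) = 0 := qpolar_eq_zero_of_isotropic hq h2 hl₀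
  -- `q(α a + β b + γ₁ y + γ₂ w) = q(γ₁ y + γ₂ w)`
  have hbin : ∀ α β γ₁ γ₂ : k, eval (α • n 0 + β • n 1 + γ₁ • n 2 + γ₂ • n 3) q =
      eval (γ₁ • n 2 + γ₂ • n 3) q := by
    intro α β γ₁ γ₂
    have hpol : qpolar q (α • n 0 + β • n 1) (γ₁ • n 2 + γ₂ • n 3) = 0 := by
      simp only [qpolar_add_left, qpolar_add_right, qpolar_smul_left, qpolar_smul_right, hA2, hA3, hB2,
        hB3, mul_zero, add_zero]
    rw [show α • n 0 + β • n 1 + γ₁ • n 2 + γ₂ • n 3 = (α • n 0 + β • n 1) + (γ₁ • n 2 + γ₂ • n 3) by abel,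
      eval_add_eq_qpolar hq h2, hl₀, hpol, zero_add, zero_add]
  -- an isotropic direction `(r₁, r₂)` of the binary form
  obtain ⟨r₁, r₂, hr, hriso⟩ := exists_isotropic_combination hq h2 (n 2) (n 3)
  -- normalised dual forms `λ₂(y) = 1`, `λ₃(w) = 1`
  have h013 : LinearIndependent k ![n 0, n 1, n 3] := by
    have h := hn.comp ![(0 : Fin 4), 1, 3] (by decide)
    convert h using 1
    funext a; fin_cases a <;> rfl
  have h2' : n 2 ∉ Submodule.span k (Set.range ![n 0, n 1, n 3]) := by
    rw [range_vec3_eq_image]; exact hn.notMem_span_image (s := {0, 1, 3}) (x := 2) (by decide)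
  obtain ⟨lam₂, hlam₂hom, hlam₂van, hlam₂y⟩ := exists_linearForm_vanishing_eval_ne_zero h013 h2'
  have h012 : LinearIndependent k ![n 0, n 1, n 2] := by
    have h := hn.comp ![(0 : Fin 4), 1, 2] (by decide)
    convert h using 1
    funext a; fin_cases a <;> rfl
  have h3' : n 3 ∉ Submodule.span k (Set.range ![n 0, n 1, n 2]) := by
    rw [range_vec3_eq_image]; exact hn.notMem_span_image (s := {0, 1, 2}) (x := 3) (by decide)
  obtain ⟨lam₃, hlam₃hom, hlam₃van, hlam₃w⟩ := exists_linearForm_vanishing_eval_ne_zero h012 h3'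
  obtain ⟨φ₂, hφ₂⟩ := exists_linearMap_forall_eval_eq hlam₂hom
  obtain ⟨φ₃, hφ₃⟩ := exists_linearMap_forall_eval_eq hlam₃hom
  have v20 : φ₂ (n 0) = 0 := by rw [← hφ₂]; exact hlam₂van _ (Submodule.subset_span ⟨0, rfl⟩)
  have v21 : φ₂ (n 1) = 0 := by rw [← hφ₂]; exact hlam₂van _ (Submodule.subset_span ⟨1, rfl⟩)
  have v23 : φ₂ (n 3) = 0 := by rw [← hφ₂]; exact hlam₂van _ (Submodule.subset_span ⟨2, rfl⟩)
  have v30 : φ₃ (n 0) = 0 := by rw [← hφ₃]; exact hlam₃van _ (Submodule.subset_span ⟨0, rfl⟩)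
  have v31 : φ₃ (n 1) = 0 := by rw [← hφ₃]; exact hlam₃van _ (Submodule.subset_span ⟨1, rfl⟩)
  have v32 : φ₃ (n 2) = 0 := by rw [← hφ₃]; exact hlam₃van _ (Submodule.subset_span ⟨2, rfl⟩)
  set c₂ := eval (n 2) lam₂ with hc₂
  set c₃ := eval (n 3) lam₃ with hc₃
  -- `λ = (r₂ / c₂) λ₂ - (r₁ / c₃) λ₃`, `λ(α a + β b + γ₁ y + γ₂ w) = r₂ γ₁ - r₁ γ₂`
  let lam : MvPolynomial (Fin (d + 1 + 1)) k := MvPolynomial.C (r₂ / c₂) * lam₂ - MvPolynomial.C (r₁ / c₃) * lam₃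
  have hlamhom : lam.IsHomogeneous 1 := (hlam₂hom.C_mul _).sub (hlam₃hom.C_mul _)
  have hlamval : ∀ cf : Fin 4 → k, eval (∑ c', cf c' • n c') lam = r₂ * cf 2 - r₁ * cf 3 := by
    intro cf
    have hy2 : φ₂ (n 2) = c₂ := by rw [← hφ₂]
    have hw3 : φ₃ (n 3) = c₃ := by rw [← hφ₃]
    simp only [lam, map_sub, map_mul, MvPolynomial.eval_C, hφ₂, hφ₃, Fin.sum_univ_four, map_add, map_smul,
      v20, v21, v23, v30, v31, v32, hy2, hw3, smul_eq_mul, zero_add, add_zero, mul_zero]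
    field_simp
  have hq_of_lam : ∀ v ∈ Submodule.span k (Set.range n), eval v lam = 0 → eval v q = 0 := by
    intro v hv hvlam
    obtain ⟨cf, rfl⟩ := (Submodule.mem_span_range_iff_exists_fun k).1 hv
    rw [hlamval] at hvlam
    -- `(γ₁, γ₂) = s (r₁, r₂)`
    obtain ⟨s, hs2, hs3⟩ : ∃ s : k, cf 2 = s * r₁ ∧ cf 3 = s * r₂ := by
      by_cases hr₁ : r₁ = 0
      · have hr₂ : r₂ ≠ 0 := hr.resolve_left (fun h => h hr₁)
        have hcf2 : cf 2 = 0 := by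
          rw [hr₁, zero_mul, sub_zero] at hvlam
          exact (mul_eq_zero.1 hvlam).resolve_left hr₂
        exact ⟨cf 3 / r₂, by rw [hcf2, hr₁, mul_zero], by rw [div_mul_cancel₀ _ hr₂]⟩
      · refine ⟨cf 2 / r₁, by rw [div_mul_cancel₀ _ hr₁], ?_⟩
        rw [div_mul_eq_mul_div, eq_div_iff hr₁]
        linear_combination -hvlam
    rw [Fin.sum_univ_four, hbin, hs2, hs3, mul_smul, mul_smul, ← smul_add, eval_smul_eq_sq_mul hq h2, hriso,
      mul_zero]
  have hzero := hnoplane' lam hlamhom hq_of_lam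
  have hy := hzero _ (hnmem 2)
  have hw := hzero _ (hnmem 3)
  have hy' : eval (∑ c', (Pi.single 2 1 : Fin 4 → k) c' • n c') lam = r₂ := by
    rw [hlamval]; simp
  have hw' : eval (∑ c', (Pi.single 3 1 : Fin 4 → k) c' • n c') lam = -r₁ := by
    rw [hlamval]; simp
  have hs2 : ∑ c', (Pi.single 2 1 : Fin 4 → k) c' • n c' = n 2 := by
    rw [Fin.sum_univ_four]; simp
  have hs3 : ∑ c', (Pi.single 3 1 : Fin 4 → k) c' • n c' = n 3 := by
    rw [Fin.sum_univ_four]; simp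
  rw [hs2, hy] at hy'
  rw [hs3, hw] at hw'
  rcases hr with h | h
  · exact h (neg_eq_zero.1 hw'.symm)
  · exact h hy'.symm

end Main

end ProjFamily

end Literature.AlgebraicGeometry.Motives
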